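import Summits.BirchSwinnertonDyer.BirchSwinnertonDyer.Theorems.ErratumRoadFiveEulerHalfJetchevMaxHLAtPConsumer
import Summits.BirchSwinnertonDyer.BirchSwinnertonDyer.Theorems.ErratumRoadFiveJetchevAtPSwapEndOfHGZ
import Summits.BirchSwinnertonDyer.BirchSwinnertonDyer.Theorems.ErratumRoadFiveMcCallumUpperOfHGZ
import HarnessLib

/-!
# Crux `EulerHalfNotRamNoInertSetAtFive` (item stmt-BirchSwinnertonDyer-19715), S1b branch OVER AN hGZ RECEPTACLE — the CONSUMER:
# the Euler-system half on mono-carrier ¬(ram) ∧ surj X11b pairs and the residual S1b, with [GZ86 III (3.1)] replaced by a PER-CURVE receptacle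

Cell `bsd-stepL`, seat `bsd-line-er5-p1-w2` g6 (D-0154 width seat -w2; LEAD `bsd-line-er5-p1` g3), `--supports stmt-BirchSwinnertonDyer-19715`
(helper). THEOREMS ONLY (no definition, no named fact, no `sorry`). Top of the chain `…JetchevAtPSupplyOfHGZ` (site (i)) → `…JetchevAtPSwapEndOfHGZ`
(sites (i)–(ii)) ∕ `…McCallumUpperOfHGZ` (sites (iii)–(iv)) → THIS FILE.

WHY. Conjunct 2 of item 27981 (`Gross1991_heegnerPoint_sub_ratTorsion_mem_E0_imageFree`, [GZ86 III (3.1)], primary source unheld) reaches crux 19715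
only through its S1b branch, at four hGZ-keyed sites; -w5 g0's «modular aux-norm» (p651087–p651089, p651502, …) supplies the receptacle on S1b rows from
tree theorems. This file is the LEAD's consumer (`…EulerHalfJetchevMaxHLAtPConsumer`, p612480) re-keyed: the named fact `hMcU` and the binder `hJmax` are
replaced by the receptacle-fed theorems of the two companion files, and the S1b statement gains ONE hypothesis — the receptacle for the curve at hand.

* `shaIndexBound_sharp_at_of_globalDivisibility` — §1 with McCallum's upper form supplied AT THE FRAME (`hMcUat`).
* `missingUpperBoundAt_of_classX11b_of_surj_of_not_ram_of_monoCarrier_of_lowerX11a_of_hGZ` — §3 over the receptacle for `W`.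
* **`res_pOnlyMultCarrierAtFive_of_lowerX11aAt_of_hGZ`** — S1b's registered text + the X11a lower half AT `p` + the receptacle hypothesis, from the Cassels–Tate
  level inputs, Gross Prop. 3.7 (2), Poitou–Tate for Selmer structures and the published facts — NO [GZ86 III (3.1)].
  -- adapted from Summits/BirchSwinnertonDyer/BirchSwinnertonDyer/Theorems/ErratumRoadFiveEulerHalfJetchevMaxHLAtPConsumer.lean

HONEST FRAMING: CONDITIONAL on every displayed binder (published named facts as hypotheses; `hPT`, `hCTi` typed-not-proved; `hX11a` = the open crux
`X11aLowerHalf`; the receptacle); nothing booked; no census label moves (T7); crux 19715 is NOT closed by this helper; no summit statement is touched;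
BSD is proved for no curve.
[cite: Jetchev2008, Thm. 1.4, Cor. 1.5 (p. 812)] [cite: McCallumLMS1991, §5 Lemma 5.1, Cor. 5.6 (pp. 303, 310)] [cite: GrossLMS1991, Prop. 3.7 (2), §4 (4.1)]
[cite: Darmon2004, Thm. 3.6] [cite: JetchevSkinnerWan2017, §7.4.2 (p. 31)] [cite: SilvermanATAEC1994, Cor. IV.9.2 (d)] [cite: Miller2011LMS, Def. 1.1]
[cite: Wuthrich2014, Lemma 20 (p. 399)]
-/

set_option autoImplicit false
set_option linter.dupNamespace false

noncomputable section

open scoped Classical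

namespace Summit.BirchSwinnertonDyer.BirchSwinnertonDyer.Theorems.JetchevMaxHLAtP

open WeierstrassCurve NumberField IsDedekindDomain Rat.HeightOneSpectrum
  Literature.NumberTheory.EllipticCurves
  Literature.NumberTheory.EllipticCurves.ModularForms
  Literature.NumberTheory.EllipticCurves.Rank1Residual
  Literature.NumberTheory.EllipticCurves.Rank1Residual.Typed
  Summit.BirchSwinnertonDyer.Rank1Residual Summit.BirchSwinnertonDyer.Rank1Residual.X11b
  Summit.BirchSwinnertonDyer.Rank1Residual.X11b.Three.Koly

/-! ### §1 One frame: global divisibility + McCallum's upper form AT THE FRAME ⇒ the sharpened bound over `K` -/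

/-- **The Tamagawa-sharpened Kolyvagin bound over `K` from global divisibility, McCallum's upper form supplied AT THE FRAME** — the LEAD's
`shaIndexBound_sharp_of_globalDivisibility` (p612480) with the named fact `hMcU` replaced by its body at this one frame (`hMcUat`), so that a
per-curve derivation of McCallum Cor. 5.6 (upper) can feed it: rank one, no `p`-torsion, `Ш(E∕K)` finite, global `p^s`-divisibility of the derived
points to depth `t` ⟹ `ord_p #Ш(E∕K) + 2t ≤ 2·ord_p [E(K):ℤP]`. [cite: McCallumLMS1991, §5 Lemma 5.1, Cor. 5.6 (pp. 303, 310)] -/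
theorem shaIndexBound_sharp_at_of_globalDivisibility
    (W : WeierstrassCurve ℚ) [W.IsElliptic] [W.IsGloballyMinimal] [NeZero (W.conductorNorm ℤ)]
    (p : ℕ) [Fact p.Prime] (K : Type) [Field K] [NumberField K]
    (Dt : ModularParametrizationData W (W.conductorNorm ℤ)) (β : ℤ) (ι : K →+* ℂ)
    (P : (W.baseChange K).toAffine.Point) (hPinf : ¬ IsOfFinAddOrder P)
    (hrank : (W.baseChange K).mordellWeilRank = 1)
    (hiv : ∀ x : (W.baseChange K).toAffine.Point, p • x = 0 → x = 0)
    [Finite (W.baseChange K).sha] {t : ℕ}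
    (hglob : ∀ (s : ℕ), s ≤ t → ∀ (n : ℕ) (d : KolyvaginHeegnerData Dt β ι n), Squarefree n →
      (∀ ℓ ∈ n.primeFactors, Zhang2014.IsKolyvaginPrime (W.conductorNorm ℤ) W K p ℓ ∧
        s ≤ Zhang2014.kolyvaginIndex W p ℓ) → PDiv d p s)
    -- McCallum Cor. 5.6 (upper form) AT THIS FRAME — the body of the named fact at `(W, K, p, Dt, β, ι, P)`
    (hMcUat : ∀ (M₀ : ℕ), (∃ Q : (W.baseChange K).toAffine.Point, ((p ^ M₀ : ℕ) : ℤ) • Q = P) →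
      (¬ ∃ Q : (W.baseChange K).toAffine.Point, ((p ^ (M₀ + 1) : ℕ) : ℤ) • Q = P) →
      (∀ (s : ℕ), s ≤ t → ∀ (n : ℕ) (d : KolyvaginHeegnerData Dt β ι n), Squarefree n →
        (∀ ℓ ∈ n.primeFactors, Zhang2014.IsKolyvaginPrime (W.conductorNorm ℤ) W K p ℓ ∧
          s ≤ Zhang2014.kolyvaginIndex W p ℓ) →
        ∃ Q : (W.baseChange (ringClassField K ι n)).toAffine.Point, ((p ^ s : ℕ) : ℤ) • Q = d.derivedPoint) →
      padicValNat p (Nat.card (AddCommGroup.primaryComponent (W.baseChange K).sha p)) + 2 * t ≤ 2 * M₀) :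
    padicValNat p (Nat.card (W.baseChange K).sha) + 2 * t ≤
      2 * padicValNat p (AddSubgroup.zmultiples P).index := by
  -- adapted from Summits/BirchSwinnertonDyer/BirchSwinnertonDyer/Theorems/ErratumRoadFiveEulerHalfJetchevMaxHLAtPConsumer.lean (§1)
  have hp : p.Prime := Fact.out
  -- the exponent p^{M₀} ∥ P (Mordell–Weil)
  haveI : Module.Finite ℤ (W.baseChange K).toAffine.Point := (W.baseChange K).module_finite_point_holds
  obtain ⟨M₀, x₀, hx₀, hmax⟩ := exists_pow_smul_eq_and_forall_ne hPinf (p := p) hp.one_lt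
  have hdiv : ∃ Q : (W.baseChange K).toAffine.Point, ((p ^ M₀ : ℕ) : ℤ) • Q = P :=
    ⟨x₀, by rw [natCast_zsmul]; exact hx₀⟩
  have hndiv : ¬ ∃ Q : (W.baseChange K).toAffine.Point, ((p ^ (M₀ + 1) : ℕ) : ℤ) • Q = P := by
    rintro ⟨Q, hQ⟩
    exact hmax Q (by rw [← natCast_zsmul]; exact hQ)
  -- McCallum's Cor. 5.6, upper form, at this frame
  have hle : padicValNat p (Nat.card (AddCommGroup.primaryComponent (W.baseChange K).sha p)) + 2 * t ≤
      2 * M₀ :=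
    hMcUat M₀ hdiv hndiv (fun s hs n d hn hℓ ↦ hglob s hs n d hn hℓ)
  have hsha : padicValNat p (Nat.card (AddCommGroup.primaryComponent (W.baseChange K).sha p)) =
      padicValNat p (Nat.card (W.baseChange K).sha) :=
    padicValNat_card_addPrimaryComponent (A := (W.baseChange K).sha) p
  haveI : Finite (AddCommGroup.torsion (W.baseChange K).toAffine.Point) :=
    WeierstrassCurve.finite_torsion_point (W := W.baseChange K)
  obtain ⟨c, Q, hcQ, hcker⟩ := RankOne.exists_coord_of_mordellWeilRank_eq_one (W.baseChange K) hrank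
  have hidx : padicValNat p (AddSubgroup.zmultiples P).index = M₀ :=
    padicValNat_index_zmultiples_eq_of_divisibility c Q hcQ hcker hiv P hdiv hndiv
  rw [hidx, ← hsha]
  exact hle

/-! ### §2 Class level at a general odd `p`: ¬(ram) ∧ surj ∧ MONO-carrier, over the receptacle -/

/-- **The Euler-system half on MONO-CARRIER ¬(ram) ∧ surj X11b pairs at an odd prime `p`, OVER THE hGZ RECEPTACLE** — the LEAD's
`missingUpperBoundAt_of_classX11b_of_surj_of_not_ram_of_monoCarrier_of_jetchevMaxHL_of_lowerX11a` (p612480 §3) with its two consumers of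
[GZ86 III (3.1)] re-keyed to the receptacle for THIS curve (`hRcpW`: at every Heegner field `K` with `d_K < −4` and every conductor frame, the
conclusion of `JET.hGZ_of_Gross1991`): `hJmax` ↦ `AtP.Koly.jetchevMaxHLAtP_of_swapLiterature_of_hGZ` (sites (i)–(ii), FOUR printed facts {Gross
Prop. 3.7 (2) `h372`, Gross–Zagier, modularity, Poitou–Tate for Selmer structures `hPT`}), `hMcU` ↦
`KolyvaginOrder.padicValNat_card_sha_primary_add_le_at_of_globalDivisibility_of_casselsTate_of_prop37_of_hGZ` (sites (iii)–(iv), {Cassels–Tate level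
inputs `hCTi`, `h372`}). Mechanism otherwise VERBATIM: the odd Manin-good Hoffstein–Luo frame, the conductor-1 datum with bottom point `y_K` (`hrec`,
`hD36`), HL(`p`) at the carrier `v` to depth `ord_p ∏c`, §1, the twist transports, the X11a lower half on the twist, x11b3's descent
`missingUpperBoundAt_of_shaIndexBound_sharp`. CONDITIONAL on every binder (`hX11a` = open crux `X11aLowerHalf`; the receptacle); nothing booked.
[cite: Jetchev2008, Thm. 1.4, Cor. 1.5 (p. 812)] [cite: McCallumLMS1991, §5 Cor. 5.6 (p. 310)] [cite: JetchevSkinnerWan2017, §7.4.2 (p. 31)]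
[cite: Darmon2004, Thm. 3.6] [cite: Miller2011LMS, Def. 1.1] -/
theorem missingUpperBoundAt_of_classX11b_of_surj_of_not_ram_of_monoCarrier_of_lowerX11a_of_hGZ
    -- published named facts
    (hGZ : ∀ (N : ℕ) [NeZero N] (W : WeierstrassCurve ℚ) (K : Type) [Field K] [NumberField K],
      gross_zagier N W K)
    (hKo : ∀ (N : ℕ) [NeZero N] (W : WeierstrassCurve ℚ) (K : Type) [Field K] [NumberField K],
      kolyvagin N W K)
    (hGZK : rank_eq_analyticRank_of_analyticRank_le_one) (hmod : hasEntireLFunction_rat)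
    (hnf : exists_isNewformOf) (hHL : HoffsteinLuo1997_exists_twist_L_one_ne_zero)
    (hMaz : mazur_not_dvd_maninConstant_of_odd)
    (hrec : ∀ (N : ℕ) [NeZero N] (W : WeierstrassCurve ℚ) (K : Type) [Field K] [NumberField K],
      heegnerPointOfConductor_one_galoisConj N W K)
    (hD36 : ∀ (N : ℕ) [NeZero N] (W : WeierstrassCurve ℚ) (K : Type) [Field K] [NumberField K],
      phi_heegnerTau_mem_singularModuliField N W K)
    (hCTi : ∀ (K : Type) [Field K] [NumberField K], casselsTate_levelInputs K)
    (h372 : GrossLMS1991.prop37_2_frobeniusCongruence)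
    (hPT : ∀ (K : Type) [Field K] [NumberField K],
      Literature.NumberTheory.GaloisCohomology.poitouTate_selmerStructure_duality_conj K)
    (p : ℕ) [Fact p.Prime] (hp2 : p ≠ 2)
    -- the X11a lower half at p (crux `X11aLowerHalf`, binder h₃ of the route's `closes`)
    (hX11a : ∀ (Wd : WeierstrassCurve ℚ) [Wd.IsElliptic] [Wd.IsGloballyMinimal],
      ClassX11a Wd p → Typed.MissingLowerBoundAt Wd p)
    -- the pair
    (W : WeierstrassCurve ℚ) [W.IsElliptic] [W.IsGloballyMinimal]
    (hX : ClassX11b W p) (hρ : Surj W p) (hnram : ¬ Ram W p)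
    (hmono : ∃ v : HeightOneSpectrum (𝓞 ℚ),
      padicValNat p W.tamagawaProduct ≤ padicValNat p (W.tamagawaNumberAt v))
    -- the hGZ RECEPTACLE for THIS curve at `p` (in place of [GZ86 III (3.1)]): at every Heegner field with `d_K < −4` and every frame
    (hRcpW : ∀ [NeZero (W.conductorNorm ℤ)] (K : Type) [Field K] [NumberField K], IsImaginaryQuadratic K →
      NumberField.discr K < -4 → SatisfiesHeegnerHypothesis (W.conductorNorm ℤ) K →
      ∀ (Dt : ModularParametrizationData W (W.conductorNorm ℤ)) (β : ℤ) (ι : K →+* ℂ),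
      ∃ n' : ℤ, IsCoprime (p : ℤ) n' ∧ ∀ (m : ℕ), Squarefree m →
        (∀ q ∈ m.primeFactors, Zhang2014.IsKolyvaginPrime (W.conductorNorm ℤ) W K p q) →
        ∀ (dm : KolyvaginHeegnerData Dt β ι m)
          (γ : ringClassField K ι m ≃ₐ[ℚ] ringClassField K ι m), γ ∈ ringClassGal ι m →
          ∀ v : HeightOneSpectrum (𝓞 K), ¬ (W.baseChange K).HasGoodReductionAt v →
            n' • pointsMap (W.baseChange K) (v.adicCompletion K)
                (dm.toGeomPoints (pointGalHom W (ringClassField K ι m) γ dm.y)) ∈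
              E0Receptacle (W.baseChange K) v ∧
            ∀ (ℓ : ℕ), ℓ ∈ m.primeFactors → ∀ (dm' : KolyvaginHeegnerData Dt β ι (m / ℓ))
              (hle : ringClassField K ι (m / ℓ) ≤ ringClassField K ι m),
              n' • pointsMap (W.baseChange K) (v.adicCompletion K)
                  (dm.toGeomPoints (pointGalHom W (ringClassField K ι m) γ
                    (WeierstrassCurve.Affine.Point.map (W' := W)
                      ((RingClassField.inclusion ι hle).restrictScalars ℚ) dm'.y))) ∈
                E0Receptacle (W.baseChange K) v) :
    Typed.MissingUpperBoundAt W p := by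
  have hp : p.Prime := Fact.out
  haveI : NeZero (W.conductorNorm ℤ) := ⟨(W.conductorNorm_pos_holds).ne'⟩
  obtain ⟨hr, -, hmult, hirr⟩ := id hX
  obtain ⟨v, hv⟩ := hmono
  -- ONE odd Heegner datum with a Manin-good frame (Hoffstein–Luo field with d_K < −4; Mazur; w_K = 2)
  -- (inline `X11b.exists_oddHeegnerData` with `d_K < −4` kept: Hoffstein–Luo field, Manin-good datum, minimal model of the twist)
  have hw : W.rootNumber = -1 := by
    rw [WeierstrassCurve.rootNumber_eq_neg_one_pow_analyticRank_of_exists_isNewformOf hnf W, hr]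
    norm_num
  obtain ⟨K, _, _, hK, hodd, hlt, hHN, hHp, hLt⟩ :=
    exists_admissibleField_of_rootNumber_eq_neg_one hnf hHL W hw p
  have hpd : ¬ (p : ℤ) ∣ NumberField.discr K := not_dvd_discr_of_split hK hp hp2 hHp
  have hμ : ¬ p ∣ Units.torsionOrder K := by
    haveI : IsTotallyComplex K := hK.2
    rw [Literature.NumberTheory.DiophantineGeometry.torsionOrder_eq_two_of_discr_lt hK.1 hlt]
    intro h2
    have := Nat.le_of_dvd two_pos h2
    have := hp.two_le
    omega
  obtain ⟨Dt, H, ι, P, hP, hc⟩ :=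
    exists_maninDatum_of_odd hnf hMaz integral_neronScaling_of_isGloballyMinimal_holds W p (W.conductorNorm ℤ)
      K rfl hp2 hmult hirr hK hHN
  have hD0' : (NumberField.discr K : ℚ) ≠ 0 := by exact_mod_cast NumberField.discr_ne_zero K
  haveI hEt' : (W.quadraticTwist (NumberField.discr K : ℚ)).IsElliptic := W.isElliptic_quadraticTwist hD0'
  obtain ⟨Cd, hCd⟩ := hasGlobalMinimalModel_rat_holds (W.quadraticTwist (NumberField.discr K : ℚ))
  set Wd : WeierstrassCurve ℚ := Cd • W.quadraticTwist (NumberField.discr K : ℚ) with hWd_def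
  haveI : Wd.IsGloballyMinimal := hCd
  have hWd : Cd • W.quadraticTwist (NumberField.discr K : ℚ) = Wd := rfl
  have h3 : NumberField.discr K ≠ -3 := by omega
  have h4 : NumberField.discr K ≠ -4 := by omega
  -- a conductor-1 Kolyvagin–Heegner datum on the frame (Dt, H.β, ι), with bottom point y_K = P
  obtain ⟨d₁⟩ := exists_kolyvaginHeegnerData_one (hD36 _ W K) hK Dt H.β ι H.dvd_sq_sub
  have hPd : d₁.toGeomPoints d₁.derivedPoint = toGeomPoints (W.baseChange K) P :=
    KolyvaginBottom.toGeomPoints_derivedPoint_one_eq (hrec _ W K) hK hHN hP d₁ rfl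
  -- global divisibility to depth ord_p ∏c on this frame: the max binder at the carrier v
  -- (Jetchev's HL(`p`) over the receptacle at this frame: sites (i)–(ii), `AtP.Koly.jetchevMaxHLAtP_of_swapLiterature_of_hGZ`)
  have hJW : ∀ (s : ℕ), s ≤ padicValNat p W.tamagawaProduct →
      ∀ (n : ℕ) (d : KolyvaginHeegnerData Dt H.β ι n), Squarefree n →
        (∀ ℓ ∈ n.primeFactors, Zhang2014.IsKolyvaginPrime (W.conductorNorm ℤ) W K p ℓ ∧
          s ≤ Zhang2014.kolyvaginIndex W p ℓ) → PDiv d p s :=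
    fun s hs n d hn hℓ ↦ AtP.Koly.jetchevMaxHLAtP_of_swapLiterature_of_hGZ p hp2 h372 hGZ hmod hPT W K Dt H.β ι
      (hRcpW K hK hlt hHN Dt H.β ι) hr hmult hρ hK hHN hodd h3 hLt H.dvd_sq_sub hc v s (hs.trans hv) n d hn hℓ
  -- (McCallum Cor. 5.6 upper AT THIS CURVE over the receptacle: sites (iii)–(iv))
  have hCM : ¬ W.HasCM := not_hasCM_of_hasMultiplicativeReductionAtPrime' W hmult
  have htower : ∀ j : ℕ, W.HasSurjectiveModNGaloisRep (p ^ j : ℕ) :=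
    forall_hasSurjectiveModNGaloisRep_pow_of_multiplicative_of_surj W p hp2 hmult hρ
  -- the sharpened bound over K at this datum, from the divisibility + McCallum (§1)
  have hU : Finite (W.baseChange K).sha → ¬ IsOfFinAddOrder P →
      padicValNat p (Nat.card (W.baseChange K).sha) + 2 * padicValNat p W.tamagawaProduct ≤
        2 * padicValNat p (AddSubgroup.zmultiples P).index := by
    intro hfin hPinf
    haveI : Finite (W.baseChange K).sha := hfin
    obtain ⟨hrank, -⟩ := hKo (W.conductorNorm ℤ) W K hK hHN ⟨Dt, H, ι, hP⟩ hPinf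
    have hbot := torsionBy_eq_bot_of_isImaginaryQuadratic_of_hasIrreducibleModPGaloisRep W K hK hp hirr
    have hiv : ∀ x : (W.baseChange K).toAffine.Point, p • x = 0 → x = 0 := fun x hx ↦ by
      have hmem : x ∈ AddSubgroup.torsionBy (W.baseChange K).toAffine.Point ((p : ℕ) : ℤ) := by
        rw [mem_torsionBy_iff, natCast_zsmul]
        exact hx
      rw [hbot] at hmem
      exact hmem
    exact shaIndexBound_sharp_at_of_globalDivisibility W p K Dt H.β ι P hPinf hrank hiv hJW
      (fun M₀ hdiv hndiv hg ↦
        KolyvaginOrder.padicValNat_card_sha_primary_add_le_at_of_globalDivisibility_of_casselsTate_of_prop37_of_hGZ hCTi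
          (fun N _ W' _ K' _ _ p' ↦ GrossLMS1991.prop37_2_reductionCongruence_of_frobeniusCongruence h372 N W' K' p')
          W hCM K hK h3 h4 hHN p hp2 htower (hRcpW K hK hlt hHN) Dt H.β ι d₁ P hPd hPinf M₀ hdiv hndiv _ hg)
  -- the twist: transports (no (ram) needed) and the X11a lower half at its minimal model, in print shape
  have hD0 : (NumberField.discr K : ℚ) ≠ 0 := by exact_mod_cast NumberField.discr_ne_zero K
  haveI hEt : (W.quadraticTwist (NumberField.discr K : ℚ)).IsElliptic :=
    W.isElliptic_quadraticTwist hD0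
  have hirrd : Wd.HasIrreducibleModPGaloisRep p :=
    hasIrreducibleModPGaloisRep_twist_model W p K hK.1 hirr Cd hWd
  have htam : padicValNat p Wd.tamagawaProduct = padicValNat p W.tamagawaProduct :=
    X2.padicValNat_tamagawaProduct_twist_of_heegner_of_odd W p hp2 K hK hodd hpd hHN Cd hWd
  have hu : padicValRat p (Cd.u : ℚ) = 0 :=
    padicValRat_u_eq_zero_of_twist_minimal W p K hK hHN hmult Cd hWd
  have hLt' : (W.quadraticTwist (NumberField.discr K : ℚ)).entireLFunction = Wd.entireLFunction := by
    rw [← hWd, entireLFunction_smul]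
  have hLd1 : Wd.entireLFunction 1 ≠ 0 := by rw [← hLt']; exact hLt
  have hrd0 : Wd.analyticRank = 0 := (Wd.analyticRank_eq_zero_iff_holds (hmod Wd)).2 hLd1
  have hXa : ClassX11a Wd p := X11b.classX11a_twist_of_not_ram W p hX hnram K hK hHN Cd hWd hrd0
  obtain ⟨qd, hqd, hvqd⟩ :=
    AdditivePotMult.exists_printShape_lower_of_missingLowerBoundAt_rankZero Wd hGZK hrd0 hirrd (hX11a Wd hXa)
  -- descent to ℚ (x11b3's data-level arithmetic)
  exact missingUpperBoundAt_of_shaIndexBound_sharp W p (W.conductorNorm ℤ) K Dt H ι P (hGZ _ W K)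
    (hKo _ W K) hGZK hmod hK hHN hP hp2 hc hμ hr hLt Wd Cd hWd hu htam le_rfl ⟨qd, hqd, hvqd⟩ hU

/-! ### §3 The residual S1b (p the ONLY multiplicative prime) over the receptacle -/

/-- Place ↔ prime bridge for SPLIT multiplicative reduction (the tree's `hasSplitMultiplicativeReductionAtPrime_iff_hasSplitMultiplicativeReductionAt`,
with the prime as a variable; copy of the LEAD's private helper). [folklore] -/
private theorem hasSplitMultiplicativeReductionAt_of_atPrime (W : WeierstrassCurve ℚ) [W.IsElliptic]
    (v : HeightOneSpectrum (𝓞 ℚ)) (p : ℕ) [Fact p.Prime] (hv : (primesEquiv v : ℕ) = p)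
    (h : W.HasSplitMultiplicativeReductionAtPrime p) : W.HasSplitMultiplicativeReductionAt v := by
  subst hv
  exact (hasSplitMultiplicativeReductionAtPrime_iff_hasSplitMultiplicativeReductionAt W v).mp h

/-- **S1b of crux 19715 (registered text of `stub_res_pOnlyMultCarrierAtFive`, binders VERBATIM) OVER THE hGZ RECEPTACLE — two extra hypotheses
placed last: the X11a lower half AT THE PAIR'S PRIME `p` (LEAD g4's per-prime re-key of item 19064) and the per-curve receptacle on the S1b row** — from SIX published facts (`hGZ hKo hGZK hmod hnf hHL
hMaz`), the two Literature THEOREMS `hrec` ∕ `hD36`, the Cassels–Tate level inputs, Gross Prop. 3.7 (2) image-free and Poitou–Tate for Selmer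
structures; the LEAD's `res_pOnlyMultCarrierAtFive_of_jetchevMaxHL_of_lowerX11a` (p612480 §4: the place of `p` is the unique split multiplicative place,
a mono-carrier pair) over the re-keyed mono-carrier consumer. [GZ86 III (3.1)] is NOT a hypothesis. CONDITIONAL; nothing booked; 19715 NOT closed.
[cite: Jetchev2008, Thm. 1.4 (p. 812)] [cite: SilvermanATAEC1994, Cor. IV.9.2 (d)] [cite: Miller2011LMS, Def. 1.1] -/
theorem res_pOnlyMultCarrierAtFive_of_lowerX11aAt_of_hGZ
    (hGZ : ∀ (N : ℕ) [NeZero N] (W : WeierstrassCurve ℚ) (K : Type) [Field K] [NumberField K],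
      gross_zagier N W K)
    (hKo : ∀ (N : ℕ) [NeZero N] (W : WeierstrassCurve ℚ) (K : Type) [Field K] [NumberField K],
      kolyvagin N W K)
    (hGZK : rank_eq_analyticRank_of_analyticRank_le_one) (hmod : hasEntireLFunction_rat)
    (hnf : exists_isNewformOf) (hHL : HoffsteinLuo1997_exists_twist_L_one_ne_zero)
    (hMaz : mazur_not_dvd_maninConstant_of_odd)
    (hrec : ∀ (N : ℕ) [NeZero N] (W : WeierstrassCurve ℚ) (K : Type) [Field K] [NumberField K],
      heegnerPointOfConductor_one_galoisConj N W K)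
    (hD36 : ∀ (N : ℕ) [NeZero N] (W : WeierstrassCurve ℚ) (K : Type) [Field K] [NumberField K],
      phi_heegnerTau_mem_singularModuliField N W K)
    (hCTi : ∀ (K : Type) [Field K] [NumberField K], casselsTate_levelInputs K)
    (h372 : GrossLMS1991.prop37_2_frobeniusCongruence)
    (hPT : ∀ (K : Type) [Field K] [NumberField K],
      Literature.NumberTheory.GaloisCohomology.poitouTate_selmerStructure_duality_conj K) :
    ∀ (W : WeierstrassCurve ℚ) [W.IsElliptic] [W.IsGloballyMinimal] (p : ℕ) [Fact p.Prime],
      Summit.BirchSwinnertonDyer.Rank1Residual.ClassX11b W p → 5 ≤ p →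
      Literature.NumberTheory.EllipticCurves.Rank1Residual.Surj W p →
      ¬ Literature.NumberTheory.EllipticCurves.Rank1Residual.Ram W p → p ∣ W.tamagawaProduct →
      (∀ (ℓ : ℕ) [Fact ℓ.Prime], W.HasMultiplicativeReductionAtPrime ℓ → ℓ = p) →
      W.HasSplitMultiplicativeReductionAtPrime p → p ∣ padicValInt p W.minimalDiscriminantInt →
      -- the X11a lower half AT THIS PRIME (item `X11aLowerHalf` restricted to `p`; LEAD g4 17:57:50Z)
      (∀ (Wd : WeierstrassCurve ℚ) [Wd.IsElliptic] [Wd.IsGloballyMinimal], ClassX11a Wd p → Typed.MissingLowerBoundAt Wd p) →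
      -- the hGZ receptacle for THIS curve on the S1b row
      (∀ [NeZero (W.conductorNorm ℤ)] (K : Type) [Field K] [NumberField K], IsImaginaryQuadratic K →
        NumberField.discr K < -4 → SatisfiesHeegnerHypothesis (W.conductorNorm ℤ) K →
        ∀ (Dt : ModularParametrizationData W (W.conductorNorm ℤ)) (β : ℤ) (ι : K →+* ℂ),
        ∃ n' : ℤ, IsCoprime (p : ℤ) n' ∧ ∀ (m : ℕ), Squarefree m →
        (∀ q ∈ m.primeFactors, Zhang2014.IsKolyvaginPrime (W.conductorNorm ℤ) W K p q) →
        ∀ (dm : KolyvaginHeegnerData Dt β ι m)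
          (γ : ringClassField K ι m ≃ₐ[ℚ] ringClassField K ι m), γ ∈ ringClassGal ι m →
          ∀ v : HeightOneSpectrum (𝓞 K), ¬ (W.baseChange K).HasGoodReductionAt v →
            n' • pointsMap (W.baseChange K) (v.adicCompletion K)
                (dm.toGeomPoints (pointGalHom W (ringClassField K ι m) γ dm.y)) ∈
              E0Receptacle (W.baseChange K) v ∧
            ∀ (ℓ : ℕ), ℓ ∈ m.primeFactors → ∀ (dm' : KolyvaginHeegnerData Dt β ι (m / ℓ))
              (hle : ringClassField K ι (m / ℓ) ≤ ringClassField K ι m),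
              n' • pointsMap (W.baseChange K) (v.adicCompletion K)
                  (dm.toGeomPoints (pointGalHom W (ringClassField K ι m) γ
                    (WeierstrassCurve.Affine.Point.map (W' := W)
                      ((RingClassField.inclusion ι hle).restrictScalars ℚ) dm'.y))) ∈
                E0Receptacle (W.baseChange K) v) →
      Literature.NumberTheory.EllipticCurves.Rank1Residual.Typed.MissingUpperBoundAt W p := by
  intro W _ _ p _ hX hp5 hρ hnram _ honly hsplit _ hX11a hRcpW
  have hp : p.Prime := Fact.out
  have hp2 : p ≠ 2 := by omega
  -- the place of p is the UNIQUE split multiplicative place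
  set v₀ : HeightOneSpectrum (𝓞 ℚ) := (primesEquiv (R := 𝓞 ℚ)).symm ⟨p, hp⟩ with hv₀_def
  have hv₀ : (primesEquiv v₀ : ℕ) = p := by rw [hv₀_def, Equiv.apply_symm_apply]
  have hs₀ : W.HasSplitMultiplicativeReductionAt v₀ :=
    hasSplitMultiplicativeReductionAt_of_atPrime W v₀ p hv₀ hsplit
  have huniq : ∀ v, W.HasSplitMultiplicativeReductionAt v → v = v₀ := by
    intro v hv
    haveI : Fact (primesEquiv v : ℕ).Prime := ⟨(primesEquiv v).2⟩
    have hmv : W.HasMultiplicativeReductionAtPrime (primesEquiv v : ℕ) :=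
      (hasMultiplicativeReductionAtPrime_primesEquiv_iff_holds W v (primesEquiv v : ℕ) rfl).mpr
        hv.hasMultiplicativeReductionAt
    have hq : (primesEquiv v : ℕ) = p := honly _ hmv
    apply (primesEquiv (R := 𝓞 ℚ)).injective
    rw [hv₀_def, Equiv.apply_symm_apply]
    exact Subtype.ext hq
  have hmono : ∃ v : HeightOneSpectrum (𝓞 ℚ),
      padicValNat p W.tamagawaProduct ≤ padicValNat p (W.tamagawaNumberAt v) :=
    ⟨v₀, (CornerLocal.padicValNat_tamagawaNumberAt_eq_of_unique_split W p hp5 hs₀ huniq).ge⟩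
  exact missingUpperBoundAt_of_classX11b_of_surj_of_not_ram_of_monoCarrier_of_lowerX11a_of_hGZ hGZ hKo hGZK
    hmod hnf hHL hMaz hrec hD36 hCTi h372 hPT p hp2 hX11a W hX hρ hnram hmono hRcpW

end Summit.BirchSwinnertonDyer.BirchSwinnertonDyer.Theorems.JetchevMaxHLAtP

end
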